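import Summits.BirchSwinnertonDyer.BirchSwinnertonDyer.Theses.UniversalToricDescent
import Summits.BirchSwinnertonDyer.BirchSwinnertonDyer.Theorems.AdditiveRankOneControlLeOfPoitouTate
import Summits.BirchSwinnertonDyer.BirchSwinnertonDyer.Theorems.WildThreeRankOneBSDpOfExactIndexManin
import Summits.BirchSwinnertonDyer.BirchSwinnertonDyer.Theorems.SchneiderFreeAdditiveX3UpperReceptacle
import Summits.BirchSwinnertonDyer.BirchSwinnertonDyer.Theorems.AdditiveWildRankOneTowerSurjOfKato
import Literature.NumberTheory.EllipticCurves.Rank1Residual.Typed.JointLower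
import Literature.NumberTheory.EllipticCurves.BSDHeegnerPointsGrossZagierProofs
import Literature.NumberTheory.EllipticCurves.KrizLi2019.SexticTwistBSDThreeDescent
import Literature.NumberTheory.EllipticCurves.GlobalMinimalModelProofs
import Literature.NumberTheory.EllipticCurves.ModularCurveManinConstantProofs
import HarnessLib

/-!
# Route `UniversalToricDescent`: the `≤` HALF of crux #5 `WildSplitControlAtThree` (stmt-BirchSwinnertonDyer-20386)
# from Poitou–Tate duality for Selmer structures ALONE, and the kernel's HARD half — the r = 1 LOWER half
# `MissingLowerBoundAt W 3` on the twin rung — WITHOUT crux #5, WITHOUT `poitouTate_sha_tateDual`, WITHOUT the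
# rank-zero wild leaf

Cell `bsd-wall` (W-ALL row 2·3@3, lane 3), seat `bsd-wall-utd-p3` (prover, gen 6), 2026-08-28. Helper for crux #5
(`--supports stmt-BirchSwinnertonDyer-20386`) and for the kernel `ToricKernelAtThree` (20390, this seat g0).

STATE BEFORE THIS FILE. Crux #5 (the pointwise control EQUALITY on the wild cell) is CLOSED MODULO exactly
PT1 = `poitouTate_selmerStructure_duality` (leaf 20461) and PT2 = `poitouTate_sha_tateDual` (leaf 20462)
(`UniversalToricDescentControl.wildSplitControlAtThree_of_poitouTate`, g5); both are global class-field-theoretic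
(Milne *ADT* I 4.10 (b)/(a)); PT1 has an active reduction line (cell bsd-schneider-ideate), PT2 has none. The kernel
(p533077) reads BSD₃(E) as STEP L ∧ co-STEP L at the Manin slack, consuming crux #5 in BOTH K1 links.

READING MADE A THEOREM HERE. PT2 enters control only through the coinvariant atom (the `≥` direction); the kernel's
HARD half — STEP L at slack `v₃(c)` (`SchneiderFree.IndexLowerBoundLeAt`: the LOWER bound on `#Ш(E/K)·∏c`, i.e. the
"main-conjecture / Eisenstein" direction `MissingLowerBoundAt`) — consumes control only as `≤`
(`AdditiveRankOneControlLe.indexLowerBoundLeAt_of_imcLowerLe_of_controlLe_zero`), and the `≤` half holds on the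
whole wild cell from PT1 and Kolyvagin's theorem alone (`AdditiveRankOneControlLe.additiveControlLeOnTreeAt_of_poitouTate_of_heegner`,
any reduction type). Hence:

* §1 `wildSplitControlLeAtThree_of_poitouTate` — crux #5's binders VERBATIM, conclusion the INEQUALITY
  `SchneiderFreeControlAtoms.AdditiveControlLeOnTreeAt 3 κ 𝔭 γ (embAt K 3 𝔭) 0 P` (+ CTL₀), from
  `hPT : ∀ K, poitouTate_selmerStructure_duality K` ALONE (g5's closer needs `hPT2` too);
  `wildSplitControlLeAtThree_of_wildSplitControlAtThree` — the crux implies its `≤` half (bookkeeping).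
* §2 `missingLowerBoundAt_three_of_transport_of_controlLe_of_twistUpper` — THE KERNEL'S HARD HALF: published inputs
  → `ToricTransportModThree` → `TwinSplitIMCAtThree` → `WildSplitWaldspurgerAtThree` → [the `≤` half of control, as a
  supplier in crux #5's binders] → [the r = 0 UPPER half of the Heegner twist, as a supplier] ⟹
  `∀ W, ClassO6 W 3 → r_an = 1 → ρ̄₃ onto → (semistable onto twin) → MissingLowerBoundAt W 3`. Same assembly as the
  kernel (Friedberg–Hoffstein field with `2` split, Heegner point, Gross–Zagier, Kolyvagin, frame `(κ, γ, 𝔭, 𝔭′)`,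
  Waldspurger value at `𝔭`, IMC EQUALITY at `E` by transport, `(log_{𝔭′}P)² = (log_𝔭 P)²`, the LOWER norm receptacle
  `Supersingular.two_mul_valuation_le_of_mem_span`), then the `≤` link, `jointLowerBoundAt_of_stepL_manin` (Gross–Zagier
  I.(7.3) bookkeeping, p528239) and `missingLowerBoundAt_of_joint_of_upper`.
* §3 `missingLowerBoundAt_three_of_transport_of_poitouTate_of_twistUpper` — §2 with the control supplier discharged by
  §1: **cruxes #2, #3, #4 + PT1 + the twist's r = 0 UPPER half ⟹ the r = 1 LOWER half on the twin rung**;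
  `missingLowerBoundAt_three_towerSurj_of_transport_of_poitouTate_of_katoTam` — the twist's upper half discharged on the
  `3`-adic TOWER-SURJECTIVE rows by Kato's Tamagawa-exact bound A161″ (kmc g20's
  `missingUpperBoundAt_twist_of_towerSurj_of_katoTam`): on those rows the HARD half of BSD₃(E) ⟸ {#2, #3, #4} ∪ {PT1} ∪
  print — crux #5, PT2, Serre 1967 / Fin_v, and the rank-zero wild leaf `WildRankZeroTwistAtThree` (#6) are NOT used;
  `missingLowerBoundAt_three_of_transport_of_poitouTate_of_wildRankZeroTwist` — the twist's upper half from leaf #6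
  instead (all twin rows, no tower hypothesis).

HONEST FRAMING: CONDITIONAL on the displayed antecedents (three research cruxes of the route, PT1, print binders);
closes no item by name (crux #5 as filed is the EQUALITY; its `≥` half and the kernel's co-STEP L / `MissingUpperBoundAt`
half still need PT2 or, on `3 ∤ c·∏c_ℓ` rows, Kolyvagin's printed bound); BSD₃ is proved for no curve.

References: [JetchevSkinnerWan2017] Thm. 3.3.1, §7.4.1 (arXiv:1512.06894 pp. 11, 30); [Castella2018] Thm. 2.3, §5;
[MilneADT2006] I Thm. 4.10(b); [GrossZagier1986] Thm. I.(6.3), (7.3), V.§2; [FriedbergHoffstein1995] Thm. B;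
[Kato2004Asterisque] Thm. 14.5 (3), Prop. 14.16 (2); [Kolyvagin1990] Thm. A; [Miller2011LMS] Def. 1.1.
-/

noncomputable section

open scoped Classical

set_option linter.dupNamespace false
set_option autoImplicit false

namespace Summit.BirchSwinnertonDyer.BirchSwinnertonDyer.Theorems.UniversalToricDescentLowerHalf

open WeierstrassCurve NumberField IsDedekindDomain Field
  Literature.NumberTheory.EllipticCurves
  Literature.NumberTheory.EllipticCurves.ModularForms
  Literature.NumberTheory.EllipticCurves.Rank1Residual
  Literature.NumberTheory.EllipticCurves.Rank1Residual.Typed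
  Literature.NumberTheory.EllipticCurves.KrizLi2019
  Literature.NumberTheory.GaloisRepresentations
  Literature.NumberTheory.GaloisCohomology
  Summit.BirchSwinnertonDyer.Rank1Residual
  Summit.BirchSwinnertonDyer.Rank1Residual.Additive
  Summit.BirchSwinnertonDyer.Rank1Residual.X11b
  Summit.BirchSwinnertonDyer.Rank1Residual.X11b.AcSelmer
  Summit.BirchSwinnertonDyer.Rank1Residual.X11b.Halves
  Summit.BirchSwinnertonDyer.BirchSwinnertonDyer.Theses.UniversalToricDescent
  Summit.BirchSwinnertonDyer.BirchSwinnertonDyer.Theorems.SchneiderFreeControlAtoms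
  Summit.BirchSwinnertonDyer.BirchSwinnertonDyer.Theorems.AdditiveRankOneControlLe

/-! ## §1. The `≤` half of crux #5 from PT1 alone -/

/-- **The `≤` HALF of crux #5 `WildSplitControlAtThree` from Poitou–Tate duality for Selmer structures ALONE.** In the
crux's own binders (the attacked wild cell `ClassO6 W 3`, `ρ̄_{E,3}` onto, `r_an = 1`, a Heegner datum over an imaginary
quadratic Heegner field `K`, non-torsion Heegner point `P`, Kolyvagin's theorem as antecedent; every anticyclotomic frame
`(κ, γ, 𝔭)` of degree one): the control INEQUALITY `AdditiveControlLeOnTreeAt 3 κ 𝔭 γ (embAt K 3 𝔭) 0 P` — i.e.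
`ord₃ f_ac(0) ≤ ord₃ #Ш(E/K)[3^∞] + 2·(ord₃ log_ω P − ord₃[E(K):ℤP]) + ord₃ ∏_{w ∣ N⁺} c_w` with CTL₀ — from
`hPT : ∀ K, poitouTate_selmerStructure_duality K`. No `poitouTate_sha_tateDual`, no Fin_v / Serre 1967, no `E(ℚ₃)[3]`
case split (cf. g5's `wildSplitControlAtThree_of_poitouTate hPT hPT2` for the EQUALITY).
[cite: JetchevSkinnerWan2017, Thm. 3.3.1 (arXiv:1512.06894 p. 11)] [cite: MilneADT2006, Ch. I, Thm. 4.10(b)]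
[cite: Kolyvagin1990, Thm. A] -/
theorem wildSplitControlLeAtThree_of_poitouTate
    (hPT : ∀ (K : Type) [Field K] [NumberField K], poitouTate_selmerStructure_duality K) :
    ∀ (W : WeierstrassCurve ℚ) [W.IsElliptic] [W.IsGloballyMinimal] (N : ℕ) [NeZero N] (K : Type)
      [Field K] [NumberField K] (Dt : ModularParametrizationData W N)
      (H : HeegnerDatum N (NumberField.discr K)) (ι : K →+* ℂ) (P : (W.baseChange K).toAffine.Point),
      ClassO6 W 3 → W.HasSurjectiveModNGaloisRep 3 → W.analyticRank = 1 → W.conductorNorm ℤ = N →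
      IsImaginaryQuadratic K → SatisfiesHeegnerHypothesis N K →
      (W.quadraticTwist (NumberField.discr K : ℚ)).entireLFunction 1 ≠ 0 →
      WeierstrassCurve.Affine.Point.map ι.toRatAlgHom P = heegnerPointComplex Dt H →
      ¬ IsOfFinAddOrder P → kolyvagin N W K →
      ∀ (κ : ZpExtension K 3), κ.IsAnticyclotomic →
        ∀ (γ : Field.absoluteGaloisGroup K) [Fact (κ.IsTopGenerator γ)]
          (𝔭 : HeightOneSpectrum (𝓞 K)) (h𝔭 : ((3 : ℕ) : 𝓞 K) ∈ 𝔭.asIdeal)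
          (he : 𝔭.asIdeal.ramificationIdx (𝓞 ℚ) = 1) (hf : 𝔭.asIdeal.inertiaDeg (𝓞 ℚ) = 1),
          AdditiveControlLeOnTreeAt 3 κ 𝔭 γ (embAt K 3 𝔭 h𝔭 he hf) 0 P := by
  intro W _ _ N _ K _ _ Dt H ι P hO6 _hsurj _hr hN hK hHe _hL1 hP hnt hKo κ hκ γ _ 𝔭 h𝔭 he hf
  exact additiveControlLeOnTreeAt_of_poitouTate_of_heegner W 3 (by decide) hO6.2.1 N K (hPT K) Dt H ι P hN hK
    hHe hP hnt hKo κ hκ γ 𝔭 h𝔭 he hf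

/-- **Crux #5 implies its `≤` half** (so every consumer below is also fed by the crux as filed). Bookkeeping. [folklore] -/
theorem wildSplitControlLeAtThree_of_wildSplitControlAtThree (hC : WildSplitControlAtThree) :
    ∀ (W : WeierstrassCurve ℚ) [W.IsElliptic] [W.IsGloballyMinimal] (N : ℕ) [NeZero N] (K : Type)
      [Field K] [NumberField K] (Dt : ModularParametrizationData W N)
      (H : HeegnerDatum N (NumberField.discr K)) (ι : K →+* ℂ) (P : (W.baseChange K).toAffine.Point),
      ClassO6 W 3 → W.HasSurjectiveModNGaloisRep 3 → W.analyticRank = 1 → W.conductorNorm ℤ = N →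
      IsImaginaryQuadratic K → SatisfiesHeegnerHypothesis N K →
      (W.quadraticTwist (NumberField.discr K : ℚ)).entireLFunction 1 ≠ 0 →
      WeierstrassCurve.Affine.Point.map ι.toRatAlgHom P = heegnerPointComplex Dt H →
      ¬ IsOfFinAddOrder P → kolyvagin N W K →
      ∀ (κ : ZpExtension K 3), κ.IsAnticyclotomic →
        ∀ (γ : Field.absoluteGaloisGroup K) [Fact (κ.IsTopGenerator γ)]
          (𝔭 : HeightOneSpectrum (𝓞 K)) (h𝔭 : ((3 : ℕ) : 𝓞 K) ∈ 𝔭.asIdeal)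
          (he : 𝔭.asIdeal.ramificationIdx (𝓞 ℚ) = 1) (hf : 𝔭.asIdeal.inertiaDeg (𝓞 ℚ) = 1),
          AdditiveControlLeOnTreeAt 3 κ 𝔭 γ (embAt K 3 𝔭 h𝔭 he hf) 0 P := by
  intro W _ _ N _ K _ _ Dt H ι P hO6 hsurj hr hN hK hHe hL1 hP hnt hKo κ hκ γ _ 𝔭 h𝔭 he hf
  exact additiveControlLeOnTreeAt_zero_of_onTreeAt
    (hC W N K Dt H ι P hO6 hsurj hr hN hK hHe hL1 hP hnt hKo κ hκ γ 𝔭 h𝔭 he hf)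

/-- **CTL₀ on the wild cell from PT1 alone**: at every frame of every cell datum, `X_ac^∅(E_K[3^∞])` is `Λ`-torsion with a
characteristic generator of non-zero constant term (the torsion guard of the transport / Eisenstein inclusions).
[cite: GreenbergLNM1716, §4 Lemma 4.2 (p. 102)] [cite: Kolyvagin1990, Thm. A] -/
theorem exists_hasCharValuationAt_wild_of_poitouTate
    (hPT : ∀ (K : Type) [Field K] [NumberField K], poitouTate_selmerStructure_duality K)
    (W : WeierstrassCurve ℚ) [W.IsElliptic] [W.IsGloballyMinimal] (N : ℕ) [NeZero N] (K : Type) [Field K]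
    [NumberField K] (Dt : ModularParametrizationData W N) (H : HeegnerDatum N (NumberField.discr K))
    (ι : K →+* ℂ) (P : (W.baseChange K).toAffine.Point) (hO6 : ClassO6 W 3) (hN : W.conductorNorm ℤ = N)
    (hK : IsImaginaryQuadratic K) (hHe : SatisfiesHeegnerHypothesis N K)
    (hP : WeierstrassCurve.Affine.Point.map ι.toRatAlgHom P = heegnerPointComplex Dt H)
    (hnt : ¬ IsOfFinAddOrder P) (hKo : kolyvagin N W K) (κ : ZpExtension K 3) (hκ : κ.IsAnticyclotomic)
    (γ : Field.absoluteGaloisGroup K) [Fact (κ.IsTopGenerator γ)] (𝔭 : HeightOneSpectrum (𝓞 K))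
    (h𝔭 : ((3 : ℕ) : 𝓞 K) ∈ 𝔭.asIdeal) :
    ∃ n : ℕ, XAc.HasCharValuationAt (W.baseChange K) 3 κ 𝔭 ∅ γ n :=
  exists_hasCharValuationAt_of_poitouTate_of_heegner W 3 (by decide) hO6.2.1 N K (hPT K) Dt H ι P hN hK hHe
    hP hnt hKo κ hκ γ 𝔭 h𝔭

/-! ## §2. The kernel's HARD half from the transport cruxes, a `≤`-control supplier and the twist's upper half -/

/-- **The r = 1 LOWER half of one cell curve from the transport cruxes, the `≤` half of control and the twist's r = 0
UPPER half.** For `E/ℚ` (globally minimal `W`) on `ClassO6 W 3` with `r_an = 1`, `ρ̄_{E,3}` onto and a semistable-at-`3`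
onto twin `W′`: published inputs → `ToricTransportModThree` → `TwinSplitIMCAtThree` → `WildSplitWaldspurgerAtThree` →
[`≤`-control at every frame of every Heegner datum of `W`, Kolyvagin as antecedent] → [r = 0 UPPER half
`MissingUpperBoundAt Wd 3` of every globally minimal model `Wd` of a Heegner twist `E^{(d_K)}` with odd `d_K` and
`L(E^{(d_K)},1) ≠ 0`] ⟹ `MissingLowerBoundAt W 3` (`ord₃ #Ш_an(E) ≤ ord₃ #Ш(E)`, the main-conjecture direction). The
kernel's assembly (this seat g0, p533077: Friedberg–Hoffstein field with `2` split so `d_K` is odd, Heegner point,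
Gross–Zagier, Kolyvagin, frame `(κ, γ, 𝔭, 𝔭′)`, Waldspurger value at `𝔭`, IMC EQUALITY at `E` by transport from the twin,
`(log_{𝔭′}P)² = (log_𝔭 P)²`, the LOWER norm receptacle `Supersingular.two_mul_valuation_le_of_mem_span`) up to T-B6-1 at
slack `v₃(c)`; then the `≤` link (`indexLowerBoundLeAt_of_imcLowerLe_of_controlLe_zero`) gives STEP L at slack `v₃(c)`,
Gross–Zagier I.(7.3) bookkeeping (`SchneiderFree.Exact.jointLowerBoundAt_of_stepL_manin`, p528239) the JOINT lower half
of `(E, E^{(d_K)})`, and the twist's upper half is subtracted (`missingLowerBoundAt_of_joint_of_upper`). NO control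
equality, NO co-STEP L, NO rank-zero wild leaf. [cite: JetchevSkinnerWan2017, §7.4.1 (arXiv:1512.06894 p. 30)]
[cite: Castella2018, Thm. 2.3 and §5 (5.1)–(5.3)] [cite: GrossZagier1986, Thm. I.(6.3), (7.3) and V.§2]
[cite: FriedbergHoffstein1995, Thm. B] [cite: Miller2011LMS, Def. 1.1] -/
theorem missingLowerBoundAt_three_of_transport_of_controlLe_of_twistUpper_at
    (hF : ToricPublishedInputs) (hT : ToricTransportModThree) (hI : TwinSplitIMCAtThree)
    (hV : WildSplitWaldspurgerAtThree) (W : WeierstrassCurve ℚ) [W.IsElliptic] [W.IsGloballyMinimal]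
    (hO6 : ClassO6 W 3) (hr : W.analyticRank = 1) (hsurj : W.HasSurjectiveModNGaloisRep 3)
    (htwin : ∃ (W' : WeierstrassCurve ℚ) (_ : W'.IsElliptic) (_ : W'.IsGloballyMinimal),
      O6.ModPCongruent W' W 3 ∧ ¬ Addv W' 3 ∧ W'.HasSurjectiveModNGaloisRep 3)
    (hCle : ∀ (N : ℕ) [NeZero N] (K : Type) [Field K] [NumberField K] (Dt : ModularParametrizationData W N)
      (H : HeegnerDatum N (NumberField.discr K)) (ι : K →+* ℂ) (P : (W.baseChange K).toAffine.Point),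
      W.conductorNorm ℤ = N → IsImaginaryQuadratic K → SatisfiesHeegnerHypothesis N K →
      (W.quadraticTwist (NumberField.discr K : ℚ)).entireLFunction 1 ≠ 0 →
      WeierstrassCurve.Affine.Point.map ι.toRatAlgHom P = heegnerPointComplex Dt H →
      ¬ IsOfFinAddOrder P → kolyvagin N W K →
      ∀ (κ : ZpExtension K 3), κ.IsAnticyclotomic →
        ∀ (γ : Field.absoluteGaloisGroup K) [Fact (κ.IsTopGenerator γ)]
          (𝔭 : HeightOneSpectrum (𝓞 K)) (h𝔭 : ((3 : ℕ) : 𝓞 K) ∈ 𝔭.asIdeal)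
          (he : 𝔭.asIdeal.ramificationIdx (𝓞 ℚ) = 1) (hf : 𝔭.asIdeal.inertiaDeg (𝓞 ℚ) = 1),
          AdditiveControlLeOnTreeAt 3 κ 𝔭 γ (embAt K 3 𝔭 h𝔭 he hf) 0 P)
    (hTwUp : ∀ (N : ℕ) [NeZero N] (K : Type) [Field K] [NumberField K]
      (Wd : WeierstrassCurve ℚ) [Wd.IsElliptic] [Wd.IsGloballyMinimal],
      W.conductorNorm ℤ = N → IsImaginaryQuadratic K → SatisfiesHeegnerHypothesis N K → Odd (NumberField.discr K) →
      (∃ C : VariableChange ℚ, C • W.quadraticTwist (NumberField.discr K : ℚ) = Wd) →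
      (W.quadraticTwist (NumberField.discr K : ℚ)).entireLFunction 1 ≠ 0 → MissingUpperBoundAt Wd 3) :
    MissingLowerBoundAt W 3 := by
  obtain ⟨W', hW'e, hW'm, hcong, hW'ss, hW'surj⟩ := htwin
  obtain ⟨hGZ, hKo, hGZK, hmod, hmodP, -, hGZ73, hFH, hpar, hHP⟩ := hF
  haveI hN0 : NeZero (W.conductorNorm ℤ) := ⟨W.conductorNorm_pos_holds.ne'⟩
  haveI hN0' : NeZero (W'.conductorNorm ℤ) := ⟨W'.conductorNorm_pos_holds.ne'⟩
  -- (a) DATA. parity: `r_an = 1` is odd, so `w(E) = -1`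
  have hw : W.rootNumber = -1 := by
    rcases W.rootNumber_eq_one_or with h | h
    · exfalso
      have heven : Even W.analyticRank := (hpar W).mpr h
      rw [hr] at heven
      exact Nat.not_even_one heven
    · exact h
  -- Friedberg–Hoffstein with auxiliary modulus `2·N(E′)`: Heegner for `N(E)`, `N(E′)`, and `2` split
  obtain ⟨K, _, _, hK, -, hHN, hH2N', hLt⟩ :=
    hFH W hw (2 * W'.conductorNorm ℤ) (mul_ne_zero two_ne_zero hN0'.out) 0
  have hHN' : SatisfiesHeegnerHypothesis (W'.conductorNorm ℤ) K :=
    SatisfiesHeegnerHypothesis.of_dvd (dvd_mul_left _ 2) hH2N'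
  have hodd : Odd (NumberField.discr K) := by
    have h8 := Literature.SatisfiesHeegnerHypothesis.discr_emod_eight hK.1 hH2N' (dvd_mul_right 2 _)
    rw [Int.odd_iff]; omega
  -- `3 ∣ N(E)` (additive) splits in `K`; `3 ∤ #𝓞_K^×`
  have h3N : 3 ∣ W.conductorNorm ℤ :=
    (W.dvd_conductorNorm_iff_not_hasGoodReductionAtPrime 3).mpr (not_good_of_addv W 3 hO6.2.1)
  have hsplit : SplitsIn K 3 := hHN 3 Nat.prime_three h3N
  have hunit : ¬ 3 ∣ Units.torsionOrder K :=
    (X11b.Three.not_dvd_discr_and_not_dvd_torsionOrder_of_heegner hK hHN (p := 3) (by decide) h3N).2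
  -- the Heegner point over `K` and its data; non-torsion by Gross–Zagier
  obtain ⟨P, Dt, H, ι, hP⟩ := hHP W K hK hHN
  have hL0 : W.entireLFunction 1 = 0 := entireLFunction_one_eq_zero_of_analyticRank_eq_one hr
  obtain ⟨-, hderiv⟩ := leadingLCoeff_eq_deriv_of_analyticRank_eq_one hr
  have hLK : LDerivEK W K ≠ 0 := by
    rw [lDerivEK_eq_deriv_mul W K hmod hL0]; exact mul_ne_zero hderiv hLt
  have hnt : ¬ IsOfFinAddOrder P :=
    (lDerivEK_ne_zero_iff_not_isOfFinAddOrder W (W.conductorNorm ℤ) K (hGZ _ W K) hK hHN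
      ⟨Dt, H, ι, hP⟩).mp hLK
  -- Kolyvagin: `rank E(K) = 1`, `Ш(E/K)` finite
  obtain ⟨hrk, hfin⟩ := hKo (W.conductorNorm ℤ) W K hK hHN ⟨Dt, H, ι, hP⟩ hnt
  -- the twin's parametrisation datum (modularity)
  obtain ⟨Dt'⟩ := hmodP W'
  -- a frame `(κ, γ, 𝔭)` and the other prime `𝔭′ ≠ 𝔭` above `3`
  obtain ⟨κ, γ, -, hκ, hγ, -⟩ := X11b.exists_anticyclotomic_generator_prime (p := 3) hK
  haveI : Fact (κ.IsTopGenerator γ) := ⟨hγ⟩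
  obtain ⟨𝔭, h𝔭, he, hf⟩ := X11b.exists_degreeOnePrime_of_splitsIn K 3 hK.1 hsplit
  obtain ⟨𝔭', hne, h𝔭', he', hf'⟩ := X11b.Three.exists_ne_degreeOne_prime hK.1 h𝔭 he hf
  -- (b) PLUMBING. Waldspurger frame and unit value at `(κ, γ, 𝔭)`
  obtain ⟨ι', hind, ΩK, Ωp, L, hΩK, hΩp, hBDP, u, hval⟩ :=
    hV W (W.conductorNorm ℤ) K Dt H ι P hO6 hsurj hr rfl hK hHN hLt hP hnt κ hκ γ 𝔭 h𝔭 he hf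
  -- the twin's IMC at `(ι′, 𝔭)` with `X_ac` strict at `𝔭′`
  obtain ⟨hex', hall'⟩ :=
    hI W' (W'.conductorNorm ℤ) K Dt' hW'ss hW'surj rfl hK hHN' κ hκ γ 𝔭 h𝔭 he hf 𝔭' h𝔭' hne ι' hind
  -- transport: IMC EQUALITY for `E` at the frame `L`
  have heq : (XAc.charIdeal (W.baseChange K) 3 κ 𝔭' ∅ γ).map (PowerSeries.map (toUnr 3)) =
      Ideal.span {L} :=
    hT W W' (W.conductorNorm ℤ) (W'.conductorNorm ℤ) K Dt Dt' hO6 hsurj hr rfl hcong hW'ss rfl hK hHN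
      hHN' κ hκ γ 𝔭 h𝔭 he hf 𝔭' h𝔭' hne ι' hind hex' hall' ΩK Ωp L hΩK hΩp hBDP
  -- the `≤` half of control at `𝔭′` (CTL₀ included) — supplier
  obtain ⟨n, hn, hnle⟩ := hCle (W.conductorNorm ℤ) K Dt H ι P rfl hK hHN hLt hP hnt (hKo _ W K) κ hκ γ 𝔭'
    h𝔭' he' hf'
  -- the value read through the logarithm at `𝔭′` (rank one: `(log_{𝔭′} P)² = (log_𝔭 P)²`)
  have hval' : L.HasValueAt 0 ((((u : unrIntegers 3) : unrIntegers 3) : ℂ_[3]) *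
      (algebraMap ℚ_[3] ℂ_[3]
        (logOmega W 3 (embAt K 3 𝔭' h𝔭' he' hf') P / (Dt.c : ℚ_[3]))) ^ 2) :=
    (SchneiderFreeAdditiveX3.hasValueAt_sq_logOmega_embAt_iff_of_rank_one W 3 hK.1 hrk h𝔭 he hf
      h𝔭' he' hf' P _ _ L).mpr hval
  -- the LOWER socket at slack `v₃(c)` at the frame `(κ, 𝔭′, γ, embAt 𝔭′)`
  have hc0 : Dt.c ≠ 0 := Dt.maninConstant_ne_zero_holds
  have hlog : logOmega W 3 (embAt K 3 𝔭' h𝔭' he' hf') P ≠ 0 := X11b.R1.logOmega_ne_zero W 3 _ hnt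
  have hlow : SchneiderFree.AdditiveIMCLowerBDPOnTreeLeAt 3 κ 𝔭' γ (embAt K 3 𝔭' h𝔭' he' hf')
      (padicValNat 3 Dt.c.natAbs) P := by
    -- the LOWER norm receptacle (`⊆` + value): `2·ord₃(log_{𝔭′}P / c) ≤ ord₃ f(0)`
    obtain ⟨htors, f, hfI, hf0, hfn⟩ := hn
    have hmem : PowerSeries.map (toUnr 3) f ∈ Ideal.span {L} := by
      have h3 := heq.le
      rw [hfI, CongruenceLimit.map_span_singleton_powerSeries] at h3
      exact (Ideal.span_singleton_le_iff_mem _).mp h3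
    obtain ⟨-, hle⟩ := Supersingular.two_mul_valuation_le_of_mem_span 3 hf0 hmem u hval'
    have hc0' : (Dt.c : ℚ_[3]) ≠ 0 := by exact_mod_cast hc0
    rw [div_eq_mul_inv, Padic.valuation_mul hlog (inv_ne_zero hc0'), Padic.valuation_inv,
      Padic.valuation_intCast, valuation_logOmega hlog, hfn] at hle
    refine ⟨n, ⟨htors, f, hfI, hf0, hfn⟩, ?_⟩
    simp only [padicValInt] at hle
    linarith
  -- STEP L at slack `v₃(c)` by the `≤` link (NO control equality)
  have hlo : SchneiderFree.IndexLowerBoundLeAt W 3 K P (padicValNat 3 Dt.c.natAbs) :=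
    indexLowerBoundLeAt_of_imcLowerLe_of_controlLe_zero rfl hK hHN hfin hlow ⟨n, hn, hnle⟩
  -- (c) a globally minimal model of the twist, the JOINT lower half, minus the twist's upper half
  have hD0 : (NumberField.discr K : ℚ) ≠ 0 := by exact_mod_cast NumberField.discr_ne_zero K
  haveI : (W.quadraticTwist (NumberField.discr K : ℚ)).IsElliptic := W.isElliptic_quadraticTwist hD0
  obtain ⟨Cd, hCd⟩ := hasGlobalMinimalModel_rat_holds (W.quadraticTwist (NumberField.discr K : ℚ))
  haveI : (Cd • W.quadraticTwist (NumberField.discr K : ℚ)).IsGloballyMinimal := hCd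
  have hJ : JointLowerBoundAt W (Cd • W.quadraticTwist (NumberField.discr K : ℚ)) 3 :=
    SchneiderFree.Exact.jointLowerBoundAt_of_stepL_manin hGZ hKo hGZK hmod hGZ73 W 3 (W.conductorNorm ℤ) K
      Dt H ι P (Cd • W.quadraticTwist (NumberField.discr K : ℚ)) hr rfl h3N hK hodd hunit hHN hLt hP
      ⟨Cd, rfl⟩ (by decide) hlo
  exact missingLowerBoundAt_of_joint_of_upper hJ
    (hTwUp (W.conductorNorm ℤ) K (Cd • W.quadraticTwist (NumberField.discr K : ℚ)) rfl hK hHN hodd ⟨Cd, rfl⟩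
      hLt)

/-! ## §3. The suppliers discharged: PT1 (§1) for control; Kato on the tower-surjective rows, or leaf #6, for the twist -/

/-- **The twist's r = 0 UPPER half from the rank-zero wild leaf #6** (`WildRankZeroTwistAtThree = WAllExclAddWildRankZero`):
a globally minimal model `Wd` of the Heegner twist `E^{(d_K)}` (odd `d_K`, `L(E^{(d_K)},1) ≠ 0`) of a cell curve with
`ρ̄_{E,3}` onto is again a NON-CM `ClassO6` row at `3` (`classO6_twist_of_heegner`: `j(Wd) = j(W)`; `hasCM_iff_of_j_eq`,
`not_hasSurjectiveModNGaloisRep_of_hasCM`) of analytic rank `0`, so the leaf pays `BSD₃(Wd)`, whence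
`MissingUpperBoundAt Wd 3` (`Ш(Wd)` finite by GZK). [cite: Zywina2015, Prop. 1.14 and Prop. 1.16] [cite: Miller2011LMS, Def. 1.1] -/
theorem missingUpperBoundAt_twist_of_wildRankZeroTwist (hGZK : rank_eq_analyticRank_of_analyticRank_le_one)
    (hZ : WildRankZeroTwistAtThree) (W : WeierstrassCurve ℚ) [W.IsElliptic] [W.IsGloballyMinimal]
    (hO6 : ClassO6 W 3) (hsurj : W.HasSurjectiveModNGaloisRep 3) {N : ℕ} (hN : W.conductorNorm ℤ = N)
    (K : Type) [Field K] [NumberField K] (hK : IsImaginaryQuadratic K) (hHN : SatisfiesHeegnerHypothesis N K)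
    (hodd : Odd (NumberField.discr K)) (Wd : WeierstrassCurve ℚ) [Wd.IsElliptic] [Wd.IsGloballyMinimal]
    (hWd : ∃ C : VariableChange ℚ, C • W.quadraticTwist (NumberField.discr K : ℚ) = Wd)
    (hLd : (W.quadraticTwist (NumberField.discr K : ℚ)).entireLFunction 1 ≠ 0) : MissingUpperBoundAt Wd 3 := by
  obtain ⟨Cd, hCd⟩ := hWd
  have hHN' : SatisfiesHeegnerHypothesis (W.conductorNorm ℤ) K := by rw [hN]; exact hHN
  obtain ⟨hO6d, hjd⟩ := classO6_twist_of_heegner W hO6 K hK hHN' hodd Wd Cd hCd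
  have hCM : ¬ W.HasCM := fun hCM ↦
    W.not_hasSurjectiveModNGaloisRep_of_hasCM hCM Nat.prime_three (by decide) hsurj
  have hCMd : ¬ Wd.HasCM := fun h ↦ hCM ((hasCM_iff_of_j_eq hjd).mp h)
  have hD0 : (NumberField.discr K : ℚ) ≠ 0 := by exact_mod_cast NumberField.discr_ne_zero K
  haveI : (W.quadraticTwist (NumberField.discr K : ℚ)).IsElliptic := W.isElliptic_quadraticTwist hD0
  have hLd1 : Wd.entireLFunction 1 ≠ 0 := by rw [← hCd, entireLFunction_smul]; exact hLd
  have hrd : Wd.analyticRank = 0 := analyticRank_eq_zero_of_entireLFunction_one_ne_zero Wd hLd1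
  have hWdBSD : BSDp Wd 3 := (show Summit.BirchSwinnertonDyer.WAllExclAddWildRankZero from hZ) Wd hCMd hO6d hrd
  obtain ⟨-, hfinWd⟩ := hGZK Wd (by rw [hrd]; exact Nat.zero_le _)
  haveI : Finite Wd.sha := hfinWd
  exact (lower_and_upper_of_missingPPartAt Wd 3 (missingPPartAt_of_bsdp Wd 3 hWdBSD)).2

/-- **Cruxes #2, #3, #4 + PT1 + the rank-zero wild leaf #6 ⟹ the r = 1 LOWER half on every twin row.** Compared with the
kernel (`ToricKernelAtThree`: #2–#6 ⟹ `BSD₃(E)`), the HARD half `MissingLowerBoundAt W 3` drops crux #5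
(`WildSplitControlAtThree`) — hence `poitouTate_sha_tateDual`, Serre 1967 / Fin_v — its `≤` half coming from PT1 alone
(§1). Conclusion in the kernel's class binders. [cite: JetchevSkinnerWan2017, §7.4.1 (arXiv:1512.06894 p. 30)]
[cite: MilneADT2006, Ch. I, Thm. 4.10(b)] [cite: GrossZagier1986, Thm. I.(6.3) and (7.3)] [cite: FriedbergHoffstein1995, Thm. B] -/
theorem missingLowerBoundAt_three_of_transport_of_poitouTate_of_wildRankZeroTwist
    (hF : ToricPublishedInputs) (hT : ToricTransportModThree) (hI : TwinSplitIMCAtThree)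
    (hV : WildSplitWaldspurgerAtThree)
    (hPT : ∀ (K : Type) [Field K] [NumberField K], poitouTate_selmerStructure_duality K)
    (hZ : WildRankZeroTwistAtThree) :
    ∀ (W : WeierstrassCurve ℚ) [W.IsElliptic] [W.IsGloballyMinimal], ClassO6 W 3 → W.analyticRank = 1 →
      W.HasSurjectiveModNGaloisRep 3 →
      (∃ (W' : WeierstrassCurve ℚ) (_ : W'.IsElliptic) (_ : W'.IsGloballyMinimal),
        O6.ModPCongruent W' W 3 ∧ ¬ Addv W' 3 ∧ W'.HasSurjectiveModNGaloisRep 3) →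
      MissingLowerBoundAt W 3 := by
  intro W _ _ hO6 hr hsurj htwin
  have hGZK : rank_eq_analyticRank_of_analyticRank_le_one := hF.2.2.1
  exact missingLowerBoundAt_three_of_transport_of_controlLe_of_twistUpper_at hF hT hI hV W hO6 hr hsurj htwin
    (fun N _ K _ _ Dt H ι P hN hK hHe hLt hP hnt hKo κ hκ γ _ 𝔭 h𝔭 he hf ↦
      wildSplitControlLeAtThree_of_poitouTate hPT W N K Dt H ι P hO6 hsurj hr hN hK hHe hLt hP hnt hKo κ hκ γ 𝔭
        h𝔭 he hf)
    (fun N _ K _ _ Wd _ _ hN hK hHN hodd hC hLt ↦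
      missingUpperBoundAt_twist_of_wildRankZeroTwist hGZK hZ W hO6 hsurj hN K hK hHN hodd Wd hC hLt)

/-- **On the `3`-adic TOWER-SURJECTIVE twin rows the HARD half of BSD₃(E) ⟸ {#2, #3, #4} ∪ {PT1} ∪ print.** The twist's
r = 0 UPPER half is Kato's Tamagawa-exact bound A161″ transported to the Heegner twist (kmc g20's
`missingUpperBoundAt_twist_of_towerSurj_of_katoTam`: `Wd` is additive at `3` with `j(Wd) = j(W)`, `ord₃ j ≥ 0` on
`ClassO6`, tower onto). Conclusion: `∀ W, ClassO6 W 3 → r_an = 1 → ρ̄₃ onto → TowerSurjThree W → (semistable onto twin)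
→ MissingLowerBoundAt W 3`. NOT used: crux #5 `WildSplitControlAtThree`, `poitouTate_sha_tateDual`, Serre 1967 /
Fin_v, the rank-zero wild leaf `WildRankZeroTwistAtThree`. [cite: JetchevSkinnerWan2017, §7.4.1 (arXiv:1512.06894 p. 30)]
[cite: Kato2004Asterisque, Thm. 14.5 (3) (p. 236) and Prop. 14.16 (2) (p. 244)] [cite: MilneADT2006, Ch. I, Thm. 4.10(b)]
[cite: GrossZagier1986, Thm. I.(6.3) and (7.3)] -/
theorem missingLowerBoundAt_three_towerSurj_of_transport_of_poitouTate_of_katoTam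
    (hF : ToricPublishedInputs) (hT : ToricTransportModThree) (hI : TwinSplitIMCAtThree)
    (hV : WildSplitWaldspurgerAtThree)
    (hPT : ∀ (K : Type) [Field K] [NumberField K], poitouTate_selmerStructure_duality K)
    (hKatoT : Kato2004.rankZero_padicValNat_sha_add_padicValNat_tamagawa_le_of_additive_potGood_of_imageContainsSL2) :
    ∀ (W : WeierstrassCurve ℚ) [W.IsElliptic] [W.IsGloballyMinimal], ClassO6 W 3 → W.analyticRank = 1 →
      W.HasSurjectiveModNGaloisRep 3 → AdditiveThree.TowerSurjThree W →
      (∃ (W' : WeierstrassCurve ℚ) (_ : W'.IsElliptic) (_ : W'.IsGloballyMinimal),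
        O6.ModPCongruent W' W 3 ∧ ¬ Addv W' 3 ∧ W'.HasSurjectiveModNGaloisRep 3) →
      MissingLowerBoundAt W 3 := by
  intro W _ _ hO6 hr hsurj hTow htwin
  have hGZK : rank_eq_analyticRank_of_analyticRank_le_one := hF.2.2.1
  have hmod : hasEntireLFunction_rat := hF.2.2.2.1
  have hsurjn :=
    UniversalToricDescentWaldspurgerFlat.forall_hasSurjectiveModNGaloisRep_pow_three_of_towerSurjThree W hTow
  exact missingLowerBoundAt_three_of_transport_of_controlLe_of_twistUpper_at hF hT hI hV W hO6 hr hsurj htwin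
    (fun N _ K _ _ Dt H ι P hN hK hHe hLt hP hnt hKo κ hκ γ _ 𝔭 h𝔭 he hf ↦
      wildSplitControlLeAtThree_of_poitouTate hPT W N K Dt H ι P hO6 hsurj hr hN hK hHe hLt hP hnt hKo κ hκ γ 𝔭
        h𝔭 he hf)
    (fun N _ K _ _ Wd _ _ hN hK hHN _hodd hC hLt ↦
      UniversalToricDescentWaldspurgerFlat.missingUpperBoundAt_twist_of_towerSurj_of_katoTam 3 (by decide) hKatoT
        hGZK hmod W hO6.2.1
        hO6.padicValRat_j_nonneg hsurjn hN K hK hHN Wd hC hLt)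

end Summit.BirchSwinnertonDyer.BirchSwinnertonDyer.Theorems.UniversalToricDescentLowerHalf

end
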